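import Mathlib
import HarnessLib

/-!
# Kill test `SurfaceTermination` (stmt-ResolutionOfSingularities-16488), W6 escape ledger — the LATTICE LEMMA
# «a nonzero effective cycle on a negative-definite form meets some component of its support negatively»

Route `ResolutionOfSingularities/HomologicalConductor`, chain W4.4 (desk DW126 (B)(iii) / DW127 candidate (L2), lead g22).
`[OURS]` — AI-formalised, weaker than expert review; NOT a statement of any manuscript under review; ℤ-valued data only,
no resolution or cohomology-annihilator infrastructure.

If `Q` is an integer matrix whose rational extension `−Q_ℚ` is positive definite (so `Q` is the intersection form of a
negative-definite configuration `E₁,…,E_n`) and `Z = Σ Z_j E_j ≥ 0` is a nonzero integral vector, then some `j` with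
`Z_j > 0` has `(Q Z)_j = Z·E_j < 0` (`exists_pos_and_mulVec_neg`). Proof: `Σ_j Z_j (QZ)_j = Zᵀ Q Z < 0`, and a sum of
products `Z_j (QZ)_j` with `Z_j ≥ 0` can only be negative if some term with `Z_j > 0` has `(QZ)_j < 0`.
Use in the cell: PROP 21.10 / the exact escape ledger (T21-15) — a `D`-orthogonal connected configuration contracts;
Laufer-type minimality steps («Z·E_j < 0 for some j»).
-/

-- single-problem summit: the doubled namespace component is forced
set_option linter.dupNamespace false

namespace Summit.ResolutionOfSingularities.ResolutionOfSingularities.Theorems.NoZeno.NegDefSupport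

open Matrix

/-- A finite sum of integers that is negative has a negative term. [folklore] -/
theorem exists_lt_zero_of_sum_lt_zero {n : ℕ} (f : Fin n → ℤ) (h : ∑ j, f j < 0) : ∃ j, f j < 0 := by
  by_contra hcon
  simp only [not_exists, not_lt] at hcon
  exact absurd h (not_lt.mpr (Finset.sum_nonneg fun j _ => hcon j))

/-- The rational quadratic form of `Q` at the integer vector `Z` is the cast of `Σ_j Z_j (QZ)_j`. [folklore] -/
theorem cast_sum_mul_mulVec {n : ℕ} (Q : Matrix (Fin n) (Fin n) ℤ) (Z : Fin n → ℤ) :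
    ((∑ j, Z j * (Q.mulVec Z) j : ℤ) : ℚ) =
      dotProduct (fun j => (Z j : ℚ)) ((Q.map (Int.cast : ℤ → ℚ)).mulVec fun j => (Z j : ℚ)) := by
  rw [Int.cast_sum]
  unfold dotProduct
  refine Finset.sum_congr rfl fun j _ => ?_
  rw [Int.cast_mul]
  congr 1
  exact RingHom.map_mulVec (Int.castRingHom ℚ) Q Z j

/-- **(L2) Lattice lemma.** Let `Q` be an `n × n` integer matrix with `−Q_ℚ` positive definite (a negative-definite
intersection form) and `Z` a nonzero vector with nonnegative integer entries. Then there is an index `j` with `Z_j > 0`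
and `(Q Z)_j < 0`. [this work; desk W4.4 DW126 (B)(iii), candidate (L2)] -/
theorem exists_pos_and_mulVec_neg {n : ℕ} (Q : Matrix (Fin n) (Fin n) ℤ)
    (hneg : (-(Q.map (Int.cast : ℤ → ℚ))).PosDef)
    (Z : Fin n → ℤ) (hZ : ∀ i, 0 ≤ Z i) (hZ0 : Z ≠ 0) :
    ∃ j, 0 < Z j ∧ (Q.mulVec Z) j < 0 := by
  -- the rational vector `x = Z` is nonzero
  set x : Fin n → ℚ := fun j => (Z j : ℚ) with hx
  have hx0 : x ≠ 0 := by
    intro h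
    apply hZ0
    funext i
    have := congrFun h i
    simpa [hx] using this
  -- `0 < xᵀ (−Q) x`, i.e. `Σ Z_j (QZ)_j < 0`
  have hpos := (Matrix.PosDef.dotProduct_mulVec_pos hneg) hx0
  have hsum : (∑ j, Z j * (Q.mulVec Z) j : ℤ) < 0 := by
    have hq : dotProduct (star x) ((-(Q.map (Int.cast : ℤ → ℚ))).mulVec x) =
        -(((∑ j, Z j * (Q.mulVec Z) j : ℤ) : ℚ)) := by
      rw [cast_sum_mul_mulVec, Matrix.neg_mulVec, dotProduct_neg]
      rfl
    rw [hq] at hpos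
    exact_mod_cast (neg_pos.mp hpos)
  -- a negative sum has a negative term; that term has `Z_j > 0` and `(QZ)_j < 0`
  obtain ⟨j, hj⟩ := exists_lt_zero_of_sum_lt_zero _ hsum
  rcases (hZ j).lt_or_eq with hpos' | hzero
  · rcases lt_or_ge ((Q.mulVec Z) j) 0 with hlt | hge
    · exact ⟨j, hpos', hlt⟩
    · exact absurd hj (not_lt.mpr (mul_nonneg hpos'.le hge))
  · exfalso
    rw [← hzero, zero_mul] at hj
    exact lt_irrefl _ hj

end Summit.ResolutionOfSingularities.ResolutionOfSingularities.Theorems.NoZeno.NegDefSupport
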